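import Mathlib
import Literature.MathematicalPhysics.QuantumFieldTheory.Balaban1983to89.B11MeanValue190Chart
import Literature.MathematicalPhysics.QuantumFieldTheory.Balaban1983to89.B11Eq115Space

/-!
# `Balaban1983to89.B11MeanValue190Lattice` — [Balaban1985Variational] Prop. 9 (190) p. 308 «… for x ∈ Δ(y) …» READ ON THE LATTICE:
# the mean-value domination `hmv` of the (190)-knitting programme for THE GENUINE LATTICE FIELDS `x ↦ 𝓗(B)(x)`, `p ↦ (∇𝓗(B))(p)` of
# the chart (174)–(175) ON THE CONCRETE SPACE (115) (`B11Eq115Space.chartHB115`), with NO presentation letter and NO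
# differentiability letter — the concrete instance of `B11MeanValue190Chart`

statement-level skeleton of published theorems with citation tags; proofs where landed; nothing here is a claim about
the Yang–Mills mass gap.

CITATION HEADER (lean-in-tree rule 2026-08-18).  T. Bałaban, *The variational problem and background fields in renormalization group
method for lattice gauge theories*, Commun. Math. Phys. **102**, 277–309 (1985), doi:10.1007/BF01229381, bib `Balaban1985Variational`
(cell paper B11; Prop. 9 p. 309, (190) p. 308, (174)–(175) p. 305, (115) p. 294, the sizes |·|_{(−n)} p. 286).  PDF held:
`paper:balaban1985-cmp102-variational-background` (journal page = PDF page + 276); displays as transcribed and render-verified in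
`B11Eq115Space` / `B11Eq174Chart` / `B11MeanValue190Chart`.  Consumers: [Balaban1989LargeFieldI] §1 (B15), [Balaban1988Convergent] §3 (B14).

WHAT IS REPRODUCED — SKELETON rows B11.Prop9 / B11.Eq174 / B11.Eq115 (owner r08), the B15/B14 (190)-knit rows (r12/r11); GAPS
G-B15-r12-08 Addendum 3 item (e′), verbatim: *«in place of `hmv`: ℍ(0) = 0 and the pointwise differentiability of the CONCRETE ℍ of [15]
(174)–(175) along the segment τ ↦ ℍ(τB) with the derivative family fed to (190)»*.  `B11MeanValue190Chart` (p29 gen 9) proved it for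
the chart over ABSTRACT complex Banach spaces `𝒳`, `𝒴` through a presentation datum `ev x : 𝒴 →L[ℝ] E`; HERE `𝒴 := Space115 L η lev₀
lev₁ ∇` IS r08's concrete space (115) of lattice configurations `ι → V` (`V` = the fibre 𝔤ᶜ, `ι` = the points of `A′`, `κ` = the points
of `∇A′`, `∇ : (ι → V) →ₗ[ℂ] (κ → V)` the covariant-derivative datum), `𝒳 := NegSize L η levB 0 V` the block fields, the chart is
`B11Eq115Space.chartHB115`, and the presentations are the COORDINATE FUNCTIONALS `JetSup.evalCLM` (values) and
`NegSup.evalCLM ∘ JetSup.sndCLM` (covariant derivatives) — continuous linear by `B11Eq115Space` (finite lattice).  Unit `lit-balaban-p29`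
gen 9 (Phase-2 free target, G.5-34(d)), HOME `run/shared/lean/pub/lit-balaban/`.

THE PRINT.  (190) p. 308: *«|(δ/δB_ν(y′))𝓗_μ(B,x)|, |∇_x(δ/δB_ν(y′))𝓗_μ(B,x)|, … ≤ O(1)[(L^jη)^{−1}, (L^jη)^{−2}, …]·(L^{j′}η)^{−d}
exp(−⅛δ₀d(y,y′)) (190) for x ∈ Δ(y) …»*; Prop. 9 p. 309: *«The function 𝓗(B) is determined by Eqs. (174), (175) … It is an analytic
function of B»*; p. 286: *«sup_j L^jη sup_{Ω_j}|A′| = |A′|_{(−1)}»* (the weights `(L^jη)^n` of the sizes, `B11Eq115Space.levWeight`).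

WHAT THIS FILE PROVES (kernel-checked, zero `sorry`, theorems only; axioms standard; everything BY NAME from `B11MeanValue190Chart`
and `B11Eq115Space`).  Under a `Regime 𝒢 Λ W B₀ θ C₄ a₃ j a ε₄` on the concrete carriers, the analyticity letters of Prop. 4 / Sect. C
(`AnalyticOnNhd ℂ W {‖Y‖ < a₃}`, `AnalyticOnNhd ℂ T {‖Y‖ < ε₄ + a}`), `T 0 = 0`, `‖H₁B‖ < a`, and for r11's sup size
`supSize g box blk` over ANY block structure (`box`, `blk`) on the points:
* **`hmv_values_lattice`** — for the lattice field `x ↦ 𝓗(B)(x) : ι → V` with the derivative family `x ↦ (D𝓗(tB)·B)(x)`: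
  `∀ s, (∀ t, loc y (x ↦ (D𝓗(tB)·B)(x)) ≤ s) → loc y (x ↦ 𝓗(B)(x)) ≤ s`;
* **`hmv_weightedValues_lattice`** — the same for print's WEIGHTED entries `x ↦ (L^{j(x)}η)·𝓗(B)(x)` (the first weight of (190));
* **`hmv_derivs_lattice`** — for the covariant-derivative field `p ↦ (∇𝓗(B))(p) : κ → V` (`∇` = the datum `D` of the space (115)) with
  the family `p ↦ (∇(D𝓗(tB)·B))(p)`;
* **`hmv_weightedDerivs_lattice`** — the same for `p ↦ (L^{j(p)}η)²·(∇𝓗(B))(p)` (the second weight of (190)).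
`D𝓗(tB) = fderiv ℝ (chartHB115 …) (tB)` is the real Fréchet derivative of the chart (= the complex one with scalars restricted,
`B11MeanValue190Chart.fderiv_chartHB_restrictScalars`), i.e. Prop. 9's `(δ/δB)𝓗` at the point `tB` of its ball.
HONEST SCOPE.  The letters left are print's premises ((117)–(121) regime, Prop. 4 / Sect. C analyticity, `T(0) = 0`, `|H₁B|` in the
region) — nothing about differentiability or presentations.  (190) itself (row B11.Eq190, the B11 block) and the rest of GAPS
G-B15-r12-08 Addendum 3 are untouched; the transport of (190) to these lattice sizes is `B11Presentation190`.  The block fields live in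
`|·|_{(−0)} = sup|·|` on their own index `β` as in `B11Eq115Space.chartHB115`.  NOT summit progress.
-/

namespace Literature.MathematicalPhysics.QuantumFieldTheory.Balaban1983to89.B11MeanValue190Lattice

open Literature.MathematicalPhysics.QuantumFieldTheory.Balaban1983to89
open B11SectG B11SupSize190 B11Eq174Chart B11Eq115Space B11MeanValue190Chart Set Metric
open scoped NNReal

variable {ι κ β : Type} [Fintype ι] [Fintype κ] [Fintype β] {V : Type} [NormedAddCommGroup V] [NormedSpace ℂ V]
  [FiniteDimensional ℂ V] {L η : ℝ} [Fact (0 < L)] [Fact (0 < η)] {lev₀ : ι → ℕ} {lev₁ : κ → ℕ} {levB : β → ℕ}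
  {D : (ι → V) →ₗ[ℂ] (κ → V)}
variable {𝒢 : NegSize L η lev₀ 3 V →L[ℂ] Space115 L η lev₀ lev₁ D}
  {Λ : Space115 L η lev₀ lev₁ D →L[ℂ] Space115 L η lev₀ lev₁ D} {W : Space115 L η lev₀ lev₁ D → NegSize L η lev₀ 3 V}
  {T : Space115 L η lev₀ lev₁ D → Space115 L η lev₀ lev₁ D} {B₀ θ C₄ a₃ j a ε₄ : ℝ}
  {H₁ : NegSize L η levB 0 V →L[ℂ] Space115 L η lev₀ lev₁ D}
variable {g : B6.Geometry}

/-! ## §1. Values `x ↦ 𝓗(B)(x)` -/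

section Values

variable {box : g.Site → Finset ι} {blk : ι → g.Site}

/-- **`hmv` FOR THE LATTICE FIELD OF VALUES `x ↦ 𝓗(B)(x)`** of the chart (174)–(175) on the concrete space (115), at r11's sup size over
any block structure on the points, with the derivative family `x ↦ (D𝓗(tB)·B)(x)`, `t ∈ [0,1]` — the consumers' `hmv`/`hmv₀` with no
presentation and no differentiability letter. [cite: Balaban1985Variational, Prop. 9 (190) pp.308-309, (174)-(175) p.305, (115) p.294] -/
theorem hmv_values_lattice (R : Regime 𝒢 Λ W B₀ θ C₄ a₃ j a ε₄) (hj : 0 ≤ j)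
    (hW : AnalyticOnNhd ℂ W {Y | ‖Y‖ < a₃}) (hT : AnalyticOnNhd ℂ T {Y | ‖Y‖ < ε₄ + a}) (hT0 : T 0 = 0)
    {B : NegSize L η levB 0 V} (hB : ‖H₁ B‖ < a) (y : g.Site) :
    ∀ s : ℝ, (∀ t : Icc (0:ℝ) 1, (supSize g box blk : BlockNorm g (ι → V)).loc y
        (fun x => JetSup.evalCLM (levWeight L η lev₀ 1) (levWeight L η lev₁ 2) D x
          (fderiv ℝ (chartHB115 𝒢 Λ W 0 T ε₄ H₁) ((t : ℝ) • B) B)) ≤ s) →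
      (supSize g box blk : BlockNorm g (ι → V)).loc y
        (fun x => JetSup.evalCLM (levWeight L η lev₀ 1) (levWeight L η lev₁ 2) D x (chartHB115 𝒢 Λ W 0 T ε₄ H₁ B)) ≤ s :=
  hmv_supSize_chart_canonical R hj hW hT hT0
    (fun x => (JetSup.evalCLM (levWeight L η lev₀ 1) (levWeight L η lev₁ 2) D x).restrictScalars ℝ) hB y

/-- **`hmv` FOR THE WEIGHTED VALUES `x ↦ (L^{j(x)}η)·𝓗(B)(x)`** (the first weight `(L^jη)^{−1}` of (190) moved to the field, p. 286
«sup_j L^jη sup_{Ω_j}|A′| = |A′|_{(−1)}»). [cite: Balaban1985Variational, Prop. 9 (190) pp.308-309, p.286] -/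
theorem hmv_weightedValues_lattice (R : Regime 𝒢 Λ W B₀ θ C₄ a₃ j a ε₄) (hj : 0 ≤ j)
    (hW : AnalyticOnNhd ℂ W {Y | ‖Y‖ < a₃}) (hT : AnalyticOnNhd ℂ T {Y | ‖Y‖ < ε₄ + a}) (hT0 : T 0 = 0)
    {B : NegSize L η levB 0 V} (hB : ‖H₁ B‖ < a) (y : g.Site) :
    ∀ s : ℝ, (∀ t : Icc (0:ℝ) 1, (supSize g box blk : BlockNorm g (ι → V)).loc y
        (fun x => levWeight L η lev₀ 1 x • JetSup.evalCLM (levWeight L η lev₀ 1) (levWeight L η lev₁ 2) D x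
          (fderiv ℝ (chartHB115 𝒢 Λ W 0 T ε₄ H₁) ((t : ℝ) • B) B)) ≤ s) →
      (supSize g box blk : BlockNorm g (ι → V)).loc y
        (fun x => levWeight L η lev₀ 1 x •
          JetSup.evalCLM (levWeight L η lev₀ 1) (levWeight L η lev₁ 2) D x (chartHB115 𝒢 Λ W 0 T ε₄ H₁ B)) ≤ s :=
  hmv_supSize_chart_canonical R hj hW hT hT0
    (fun x => levWeight L η lev₀ 1 x •
      (JetSup.evalCLM (levWeight L η lev₀ 1) (levWeight L η lev₁ 2) D x).restrictScalars ℝ) hB y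

end Values

/-! ## §2. Covariant derivatives `p ↦ (∇𝓗(B))(p)` -/

section Derivs

variable {box : g.Site → Finset κ} {blk : κ → g.Site}

/-- **`hmv` FOR THE LATTICE FIELD OF COVARIANT DERIVATIVES `p ↦ (∇𝓗(B))(p)`** (`∇` = the derivative datum `D` of the space (115),
read through `JetSup.sndCLM`), at the sup size over any block structure on the derivative points, with the family
`p ↦ (∇(D𝓗(tB)·B))(p)` — the second line of (190)'s left-hand side. [cite: Balaban1985Variational, Prop. 9 (190) pp.308-309, (115) p.294] -/
theorem hmv_derivs_lattice (R : Regime 𝒢 Λ W B₀ θ C₄ a₃ j a ε₄) (hj : 0 ≤ j)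
    (hW : AnalyticOnNhd ℂ W {Y | ‖Y‖ < a₃}) (hT : AnalyticOnNhd ℂ T {Y | ‖Y‖ < ε₄ + a}) (hT0 : T 0 = 0)
    {B : NegSize L η levB 0 V} (hB : ‖H₁ B‖ < a) (y : g.Site) :
    ∀ s : ℝ, (∀ t : Icc (0:ℝ) 1, (supSize g box blk : BlockNorm g (κ → V)).loc y
        (fun p => NegSup.evalCLM ℂ (levWeight L η lev₁ 2) p (JetSup.sndCLM (levWeight L η lev₀ 1) (levWeight L η lev₁ 2) D
          (fderiv ℝ (chartHB115 𝒢 Λ W 0 T ε₄ H₁) ((t : ℝ) • B) B))) ≤ s) →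
      (supSize g box blk : BlockNorm g (κ → V)).loc y
        (fun p => NegSup.evalCLM ℂ (levWeight L η lev₁ 2) p (JetSup.sndCLM (levWeight L η lev₀ 1) (levWeight L η lev₁ 2) D
          (chartHB115 𝒢 Λ W 0 T ε₄ H₁ B))) ≤ s :=
  hmv_supSize_chart_canonical R hj hW hT hT0
    (fun p => ((NegSup.evalCLM ℂ (levWeight L η lev₁ 2) p).comp
      (JetSup.sndCLM (levWeight L η lev₀ 1) (levWeight L η lev₁ 2) D)).restrictScalars ℝ) hB y

/-- **`hmv` FOR THE WEIGHTED COVARIANT DERIVATIVES `p ↦ (L^{j(p)}η)²·(∇𝓗(B))(p)`** (the second weight `(L^jη)^{−2}` of (190) moved to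
the field). [cite: Balaban1985Variational, Prop. 9 (190) pp.308-309, p.286] -/
theorem hmv_weightedDerivs_lattice (R : Regime 𝒢 Λ W B₀ θ C₄ a₃ j a ε₄) (hj : 0 ≤ j)
    (hW : AnalyticOnNhd ℂ W {Y | ‖Y‖ < a₃}) (hT : AnalyticOnNhd ℂ T {Y | ‖Y‖ < ε₄ + a}) (hT0 : T 0 = 0)
    {B : NegSize L η levB 0 V} (hB : ‖H₁ B‖ < a) (y : g.Site) :
    ∀ s : ℝ, (∀ t : Icc (0:ℝ) 1, (supSize g box blk : BlockNorm g (κ → V)).loc y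
        (fun p => levWeight L η lev₁ 2 p • NegSup.evalCLM ℂ (levWeight L η lev₁ 2) p
          (JetSup.sndCLM (levWeight L η lev₀ 1) (levWeight L η lev₁ 2) D
            (fderiv ℝ (chartHB115 𝒢 Λ W 0 T ε₄ H₁) ((t : ℝ) • B) B))) ≤ s) →
      (supSize g box blk : BlockNorm g (κ → V)).loc y
        (fun p => levWeight L η lev₁ 2 p • NegSup.evalCLM ℂ (levWeight L η lev₁ 2) p
          (JetSup.sndCLM (levWeight L η lev₀ 1) (levWeight L η lev₁ 2) D (chartHB115 𝒢 Λ W 0 T ε₄ H₁ B))) ≤ s :=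
  hmv_supSize_chart_canonical R hj hW hT hT0
    (fun p => levWeight L η lev₁ 2 p • ((NegSup.evalCLM ℂ (levWeight L η lev₁ 2) p).comp
      (JetSup.sndCLM (levWeight L η lev₀ 1) (levWeight L η lev₁ 2) D)).restrictScalars ℝ) hB y

end Derivs

/-! ## §3. The pointwise bounds of Prop. 6 «This solution satisfies the bounds (115)» for the presented entries -/

omit [FiniteDimensional ℂ V] in
/-- The weighted entries are dominated by the (115) norm: `(L^{j(x)}η)·‖v(x)‖ ≤ ‖v‖` and `(L^{j(p)}η)²·‖(∇v)(p)‖ ≤ ‖v‖` — the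
pointwise compatibility of the two presentations above with the norm of the configuration space (print's «i.e.» of (115)).
[cite: Balaban1985Variational, (115) p.294, p.286] -/
theorem weighted_entries_le_norm (v : Space115 L η lev₀ lev₁ D) (x : ι) (p : κ) :
    levWeight L η lev₀ 1 x * ‖JetSup.evalCLM (levWeight L η lev₀ 1) (levWeight L η lev₁ 2) D x v‖ ≤ ‖v‖ ∧
      levWeight L η lev₁ 2 p * ‖NegSup.evalCLM ℂ (levWeight L η lev₁ 2) p
        (JetSup.sndCLM (levWeight L η lev₀ 1) (levWeight L η lev₁ 2) D v)‖ ≤ ‖v‖ :=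
  ⟨JetSup.weight_mul_norm_apply_le v x, JetSup.weight_mul_norm_deriv_le v p⟩

end Literature.MathematicalPhysics.QuantumFieldTheory.Balaban1983to89.B11MeanValue190Lattice
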